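import Summits.CriticalPhenomena.PercolationContinuityZ3.Theorems.PercNearOneGluingNoHeavyQuantIndepBlobOneLightAllFloors
import HarnessLib

/-!
# QUANT lane R8, Conjecture DIB\* with SEVERAL light blobs: all but one heavy-mergeable ⟹ the row, at every floor

builds on p205010 (kernel theorem, internal audit signed; external expert review pending)

Support file (`--supports stmt-CriticalPhenomena-4575`), QUANT lane seat prim-quant-p1 (gen 11); memo
`run/shared/lean/prim/quant/P1-SURPLUS.md` §22.  Theorems only; no definitions, no sorries, standard axioms.  One-type vocabulary (blobs `κ`,
gates `p`, integer sizes `a`, a distinguished blob `x₀`).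

**Theorem (`tail_ge_of_heavyMerge_oneLight`).**  Floor `0 < x < 1`; gates in `[0,1]`; a distinguished blob `x₀` with `x² ≤ p x₀ ≤ x` and
`a x₀ ≤ j`; every OTHER blob below the floor (`k ≠ x₀`, `p k < x`) is HEAVY-MERGEABLE: `j ≤ p k · A_H` with `A_H = Σ_{i ≠ x₀, x ≤ p i} a i`
(and then some heavy blob `i ≠ x₀` has positive size); and
`2j < Σ_{k ≠ x₀} a k · p k + a x₀ · (p x₀ − x²)/(1 − x)` — the mergeable light blobs at FULL credit, `x₀` at the DIB\* discount `κ_x`.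
Then `x ≤ P(N ≥ j+1)`.  So Conjecture DIB\* (`Quant.IndepBlob.DIBStar`) holds, with credit to spare, for every instance whose light blobs are
heavy-mergeable except possibly one (two-light corner of the census: ≈ 88 % of instances; memo §22.5).

**Proof.**  Induction on the number of light blobs other than `x₀`: merge one of them into a heavy target `ℓ ≠ x₀` by p1 g8's law-free
`Quant.Merge.exists_tailMerge_le` (targets = heavy blobs other than `x₀`, weighted by size; `j ≤ p k₀ · A_H`), pass to the subtype `{k ≠ k₀}`
(`IndepBlob.tail_split`): the tail did not go up, the heavy mass grew, the credit grew (`p ℓ ≥ x > p k₀`), `x₀` is untouched; at the end only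
`x₀` is below the floor and p1 g11's `IndepBlob.tail_ge_of_oneLight_allFloors` (merge-or-Cantelli at floors `≥ 1/2`, lead g15's discounted
Cantelli below) concludes.  [cite: KozmaNitzan2024, Conjecture 3 (p. 15)] (the gluing rows served); the row is [this work].
-/

namespace Summit.CriticalPhenomena.PercolationContinuityZ3.Theorems

namespace Quant

namespace IndepBlob

open Finset

universe u

variable {κ : Type*} [Fintype κ] [DecidableEq κ]

/-- The induction behind `tail_ge_of_heavyMerge_oneLight` (bound `n` on the number of light blobs other than `x₀`). [this work] -/
theorem tail_ge_of_heavyMerge_oneLight_le (n : ℕ) :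
    ∀ {κ : Type u} [Fintype κ] [DecidableEq κ] (p : κ → ℝ) (a : κ → ℕ) (x₀ : κ) (x : ℝ) (j : ℕ),
      (∀ k, 0 ≤ p k) → (∀ k, p k ≤ 1) → 0 < x → x < 1 →
      x ^ 2 ≤ p x₀ → p x₀ ≤ x → a x₀ ≤ j →
      ((Finset.univ : Finset κ).filter (fun k => k ≠ x₀ ∧ p k < x)).card ≤ n →
      (∀ k, k ≠ x₀ → p k < x →
        (j : ℝ) ≤ p k * ∑ i ∈ (Finset.univ : Finset κ).filter (fun i => i ≠ x₀ ∧ x ≤ p i), (a i : ℝ)) →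
      (∀ k, k ≠ x₀ → p k < x → ∃ i, i ≠ x₀ ∧ x ≤ p i ∧ 0 < a i) →
      (2 * j : ℝ) < (∑ k ∈ Finset.univ.erase x₀, (a k : ℝ) * p k) + a x₀ * ((p x₀ - x ^ 2) / (1 - x)) →
      x ≤ ∑ s ∈ (Finset.univ : Finset (Finset κ)).filter (fun s => j + 1 ≤ ∑ k ∈ s, a k),
        (∏ k, if k ∈ s then p k else 1 - p k) := by
  induction n with
  | zero =>
    intro κ _ _ p a x₀ x j hp0 hp1 hx0 hx1 hgl hgu hbj hcard hM hH hcredit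
    have hheavy : ∀ k, k ≠ x₀ → x ≤ p k := by
      intro k hk
      by_contra h
      have : k ∈ (Finset.univ : Finset κ).filter (fun k => k ≠ x₀ ∧ p k < x) :=
        Finset.mem_filter.2 ⟨Finset.mem_univ _, hk, not_le.1 h⟩
      have := Finset.card_pos.2 ⟨k, this⟩
      omega
    exact tail_ge_of_oneLight_allFloors p a x₀ x j hp0 hp1 hx0 hx1 hheavy hgl hgu hbj hcredit
  | succ n ih =>
    intro κ _ _ p a x₀ x j hp0 hp1 hx0 hx1 hgl hgu hbj hcard hM hH hcredit
    set L := (Finset.univ : Finset κ).filter (fun k => k ≠ x₀ ∧ p k < x) with hL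
    by_cases hLne : L.Nonempty
    swap
    · have hheavy : ∀ k, k ≠ x₀ → x ≤ p k := by
        intro k hk
        by_contra h
        exact hLne ⟨k, Finset.mem_filter.2 ⟨Finset.mem_univ _, hk, not_le.1 h⟩⟩
      exact tail_ge_of_oneLight_allFloors p a x₀ x j hp0 hp1 hx0 hx1 hheavy hgl hgu hbj hcredit
    obtain ⟨k₀, hk₀L⟩ := hLne
    have hk₀ : k₀ ≠ x₀ ∧ p k₀ < x := (Finset.mem_filter.1 hk₀L).2
    set ι := {k : κ // k ≠ k₀} with hι
    have hx₀k₀ : x₀ ≠ k₀ := fun h => hk₀.1 h.symm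
    set y₀ : ι := ⟨x₀, hx₀k₀⟩ with hy₀
    -- targets: heavy blobs other than `x₀`, weighted by size
    set c : ι → ℕ := fun i : ι => if (i.1 ≠ x₀ ∧ x ≤ p i.1) then a i.1 else 0 with hc
    set z : Finset ι → ℕ := fun W => ∑ i ∈ W, (if (i.1 ≠ x₀ ∧ x ≤ p i.1) then 0 else a i.1) with hz
    have hcz : ∀ W : Finset ι, ∑ i ∈ W, c i + z W = ∑ i ∈ W, a i.1 := by
      intro W
      rw [hz, ← Finset.sum_add_distrib]
      refine Finset.sum_congr rfl fun i _ => ?_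
      simp only [hc]
      split_ifs <;> simp
    have hk₀not : k₀ ∉ (Finset.univ : Finset κ).filter (fun i => i ≠ x₀ ∧ x ≤ p i) := by
      intro h
      have := (Finset.mem_filter.1 h).2.2
      linarith [hk₀.2]
    have hSumc : (∑ i : ι, (c i : ℝ)) = ∑ i ∈ (Finset.univ : Finset κ).filter (fun i => i ≠ x₀ ∧ x ≤ p i), (a i : ℝ) := by
      have h1 : (∑ i : ι, (c i : ℝ)) = ∑ i : ι, (if (i.1 ≠ x₀ ∧ x ≤ p i.1) then (a i.1 : ℝ) else 0) := by
        refine Finset.sum_congr rfl fun i _ => ?_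
        simp only [hc]
        split_ifs <;> simp
      rw [h1, ← Finset.sum_filter, sum_filter_subtype_ne k₀ (fun i => i ≠ x₀ ∧ x ≤ p i) (fun i => (a i : ℝ)),
        Finset.erase_eq_of_notMem hk₀not]
    have hMc : (j : ℝ) ≤ p k₀ * ∑ i : ι, (c i : ℝ) := by rw [hSumc]; exact hM k₀ hk₀.1 hk₀.2
    have hpos : ∃ i : ι, 0 < c i := by
      obtain ⟨i, hix, hi, hai⟩ := hH k₀ hk₀.1 hk₀.2
      have hik : i ≠ k₀ := by intro h; rw [h] at hi; linarith [hk₀.2]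
      refine ⟨⟨i, hik⟩, ?_⟩
      show 0 < (if (i ≠ x₀ ∧ x ≤ p i) then a i else 0)
      rw [if_pos ⟨hix, hi⟩]; exact hai
    -- the product weight on the subtype and THE MERGE STEP
    set μ : Finset ι → ℝ := fun W => ∏ i : ι, (if i ∈ W then p i.1 else 1 - p i.1) with hμ
    have hμ0 : ∀ W, 0 ≤ μ W := fun W =>
      bernoulliWeight_nonneg (p := fun i : ι => p i.1) (fun i => hp0 i.1) (fun i => hp1 i.1) W
    obtain ⟨ℓ, hcℓ, hmerge⟩ := Merge.exists_tailMerge_le μ hμ0 (fun W => W) z c (a k₀) j (p k₀) hMc hpos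
    have hℓ : ℓ.1 ≠ x₀ ∧ x ≤ p ℓ.1 := by
      by_contra h
      have : c ℓ = 0 := by simp only [hc]; rw [if_neg h]
      omega
    have haℓ : 0 < a ℓ.1 := by
      have : c ℓ = a ℓ.1 := by simp only [hc]; rw [if_pos hℓ]
      omega
    have hℓy₀ : ℓ ≠ y₀ := fun h => hℓ.1 (by rw [h])
    -- merged sizes
    set a' : ι → ℕ := fun i : ι => a i.1 + (if i = ℓ then a k₀ else 0) with ha'
    have ha'W : ∀ W : Finset ι, ∑ i ∈ W, a' i = ∑ i ∈ W, a i.1 + (if ℓ ∈ W then a k₀ else 0) := by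
      intro W
      rw [ha', Finset.sum_add_distrib, Finset.sum_ite_eq' W ℓ]
    have ha'y₀ : a' y₀ = a x₀ := by simp only [ha', hy₀]; rw [if_neg hℓy₀.symm]; rfl
    -- (1) original tail = T₀ ; (2) merged tail = tail of `(p, a')` on the subtype
    have hT0 : ∑ s ∈ (Finset.univ : Finset (Finset κ)).filter (fun s => j + 1 ≤ ∑ k ∈ s, a k),
          (∏ k, if k ∈ s then p k else 1 - p k) =
        ∑ W : Finset ι, μ W * (p k₀ * (if j + 1 ≤ ∑ i ∈ W, c i + z W + a k₀ then (1 : ℝ) else 0) +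
          (1 - p k₀) * (if j + 1 ≤ ∑ i ∈ W, c i + z W then (1 : ℝ) else 0)) := by
      rw [tail_split p a k₀ (j + 1)]
      simp_rw [hcz]
      rw [Finset.sum_filter, Finset.sum_filter, Finset.mul_sum, Finset.mul_sum, ← Finset.sum_add_distrib]
      refine Finset.sum_congr rfl fun W _ => ?_
      have e : a k₀ + ∑ i ∈ W, a i.1 = ∑ i ∈ W, a i.1 + a k₀ := by rw [add_comm]
      rw [e]
      split_ifs <;> ring
    have hTℓ : ∑ W : Finset ι, μ W * (if j + 1 ≤ ∑ i ∈ W, c i + z W + (if ℓ ∈ W then a k₀ else 0) then (1 : ℝ) else 0) =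
        ∑ W ∈ (Finset.univ : Finset (Finset ι)).filter (fun W => j + 1 ≤ ∑ i ∈ W, a' i), μ W := by
      rw [Finset.sum_filter]
      refine Finset.sum_congr rfl fun W _ => ?_
      rw [hcz W, ← ha'W W]
      split_ifs <;> simp
    -- (3) hypotheses of the induction hypothesis for the merged system
    have hiff : ∀ i : ι, i ≠ y₀ ↔ i.1 ≠ x₀ := fun i =>
      not_congr ⟨fun h => (congrArg Subtype.val h).trans rfl, fun h => Subtype.ext h⟩
    have hfilt_eq : (Finset.univ : Finset ι).filter (fun i : ι => i ≠ y₀ ∧ p i.1 < x) =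
        (Finset.univ : Finset ι).filter (fun i : ι => i.1 ≠ x₀ ∧ p i.1 < x) := by
      ext i
      simp only [Finset.mem_filter, Finset.mem_univ, true_and, hiff i]
    have hcard' : ((Finset.univ : Finset ι).filter (fun i : ι => i ≠ y₀ ∧ p i.1 < x)).card ≤ n := by
      rw [hfilt_eq]
      have h1 : ((Finset.univ : Finset ι).filter (fun i : ι => i.1 ≠ x₀ ∧ p i.1 < x)).card = (L.erase k₀).card := by
        rw [Finset.card_eq_sum_ones, Finset.card_eq_sum_ones, hL]
        exact sum_filter_subtype_ne k₀ (fun i => i ≠ x₀ ∧ p i < x) (fun _ => 1)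
      rw [h1, Finset.card_erase_of_mem hk₀L]
      omega
    have hheavy_eq : (Finset.univ : Finset ι).filter (fun i : ι => i ≠ y₀ ∧ x ≤ p i.1) =
        (Finset.univ : Finset ι).filter (fun i : ι => i.1 ≠ x₀ ∧ x ≤ p i.1) := by
      ext i
      simp only [Finset.mem_filter, Finset.mem_univ, true_and, hiff i]
    have hAH' : ∑ i ∈ (Finset.univ : Finset κ).filter (fun i => i ≠ x₀ ∧ x ≤ p i), (a i : ℝ) ≤
        ∑ i ∈ (Finset.univ : Finset ι).filter (fun i : ι => i ≠ y₀ ∧ x ≤ p i.1), (a' i : ℝ) := by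
      rw [hheavy_eq, ← Finset.erase_eq_of_notMem hk₀not,
        ← sum_filter_subtype_ne k₀ (fun i => i ≠ x₀ ∧ x ≤ p i) (fun i => (a i : ℝ))]
      refine Finset.sum_le_sum fun i _ => ?_
      simp only [ha']
      exact_mod_cast Nat.le_add_right (a i.1) _
    have hM' : ∀ k : ι, k ≠ y₀ → p k.1 < x →
        (j : ℝ) ≤ p k.1 * ∑ i ∈ (Finset.univ : Finset ι).filter (fun i : ι => i ≠ y₀ ∧ x ≤ p i.1), (a' i : ℝ) := by
      intro k hk hkx
      have hk' : k.1 ≠ x₀ := fun h => hk (Subtype.ext h)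
      exact (hM k.1 hk' hkx).trans (mul_le_mul_of_nonneg_left hAH' (hp0 k.1))
    have hH' : ∀ k : ι, k ≠ y₀ → p k.1 < x → ∃ i : ι, i ≠ y₀ ∧ x ≤ p i.1 ∧ 0 < a' i := by
      intro k _ _
      refine ⟨ℓ, hℓy₀, hℓ.2, ?_⟩
      simp only [ha']
      omega
    have herase_eq : (Finset.univ : Finset ι).erase y₀ = (Finset.univ : Finset ι).filter (fun i : ι => i.1 ≠ x₀) := by
      ext i
      simp only [Finset.mem_erase, Finset.mem_univ, and_true, Finset.mem_filter, true_and, hiff i]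
    have hcredit' : (2 * j : ℝ) < (∑ i ∈ (Finset.univ : Finset ι).erase y₀, (a' i : ℝ) * p i.1) +
        a' y₀ * ((p y₀.1 - x ^ 2) / (1 - x)) := by
      -- old heavy+light sum, split at `k₀`, read on the subtype
      have hsplitK : ∑ k ∈ Finset.univ.erase x₀, (a k : ℝ) * p k =
          (a k₀ : ℝ) * p k₀ + ∑ i ∈ (Finset.univ : Finset ι).filter (fun i : ι => i.1 ≠ x₀), (a i.1 : ℝ) * p i.1 := by
        rw [sum_filter_subtype_ne k₀ (fun i => i ≠ x₀) (fun i => (a i : ℝ) * p i), Finset.filter_ne']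
        exact (Finset.add_sum_erase _ (fun i => (a i : ℝ) * p i) (Finset.mem_erase.2 ⟨hk₀.1, Finset.mem_univ _⟩)).symm
      have hnew : ∑ i ∈ (Finset.univ : Finset ι).erase y₀, (a' i : ℝ) * p i.1 =
          (∑ i ∈ (Finset.univ : Finset ι).filter (fun i : ι => i.1 ≠ x₀), (a i.1 : ℝ) * p i.1) + (a k₀ : ℝ) * p ℓ.1 := by
        rw [herase_eq]
        have e : ∀ i : ι, (a' i : ℝ) * p i.1 = (a i.1 : ℝ) * p i.1 + (if i = ℓ then (a k₀ : ℝ) * p ℓ.1 else 0) := by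
          intro i
          simp only [ha']
          split_ifs with h
          · subst h; push_cast; ring
          · push_cast; ring
        have hℓmem : ℓ ∈ (Finset.univ : Finset ι).filter (fun i : ι => i.1 ≠ x₀) :=
          Finset.mem_filter.2 ⟨Finset.mem_univ _, hℓ.1⟩
        rw [Finset.sum_congr rfl fun i _ => e i, Finset.sum_add_distrib, Finset.sum_ite_eq', if_pos hℓmem]
      have hgain : (a k₀ : ℝ) * p k₀ ≤ (a k₀ : ℝ) * p ℓ.1 :=
        mul_le_mul_of_nonneg_left (by linarith [hk₀.2, hℓ.2]) (Nat.cast_nonneg _)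
      have hy₀v : (p y₀.1 - x ^ 2) / (1 - x) = (p x₀ - x ^ 2) / (1 - x) := by rw [hy₀]
      rw [hnew, ha'y₀, hy₀v]
      rw [hsplitK] at hcredit
      linarith
    have hgl' : x ^ 2 ≤ p y₀.1 := by rw [hy₀]; exact hgl
    have hgu' : p y₀.1 ≤ x := by rw [hy₀]; exact hgu
    have hbj' : a' y₀ ≤ j := by rw [ha'y₀]; exact hbj
    have IH := ih (κ := ι) (fun i : ι => p i.1) a' y₀ x j (fun i => hp0 i.1) (fun i => hp1 i.1) hx0 hx1 hgl' hgu' hbj'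
      hcard' hM' hH' hcredit'
    -- (4) assemble
    calc x ≤ ∑ W ∈ (Finset.univ : Finset (Finset ι)).filter (fun W => j + 1 ≤ ∑ i ∈ W, a' i), μ W := IH
      _ = ∑ W : Finset ι, μ W *
            (if j + 1 ≤ ∑ i ∈ W, c i + z W + (if ℓ ∈ W then a k₀ else 0) then (1 : ℝ) else 0) := hTℓ.symm
      _ ≤ _ := hmerge
      _ = _ := hT0.symm

/-- **DIB\* with several light blobs, all but one heavy-mergeable — every floor.**  Floor `0 < x < 1`; gates in `[0,1]`; the distinguished
blob `x₀` has `x² ≤ p x₀ ≤ x` and `a x₀ ≤ j`; every other blob below the floor satisfies `j ≤ p k · Σ_{i ≠ x₀, x ≤ p i} a i` (and then a heavy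
blob `i ≠ x₀` of positive size exists); `2j < Σ_{k ≠ x₀} a k p k + a x₀ (p x₀ − x²)/(1−x)` (mergeable light blobs at FULL credit).  Then
`x ≤ P(N ≥ j+1)`. [this work] -/
theorem tail_ge_of_heavyMerge_oneLight (p : κ → ℝ) (a : κ → ℕ) (x₀ : κ) (x : ℝ) (j : ℕ)
    (hp0 : ∀ k, 0 ≤ p k) (hp1 : ∀ k, p k ≤ 1) (hx0 : 0 < x) (hx1 : x < 1)
    (hgl : x ^ 2 ≤ p x₀) (hgu : p x₀ ≤ x) (hbj : a x₀ ≤ j)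
    (hM : ∀ k, k ≠ x₀ → p k < x →
      (j : ℝ) ≤ p k * ∑ i ∈ (Finset.univ : Finset κ).filter (fun i => i ≠ x₀ ∧ x ≤ p i), (a i : ℝ))
    (hH : ∀ k, k ≠ x₀ → p k < x → ∃ i, i ≠ x₀ ∧ x ≤ p i ∧ 0 < a i)
    (hcredit : (2 * j : ℝ) < (∑ k ∈ Finset.univ.erase x₀, (a k : ℝ) * p k) + a x₀ * ((p x₀ - x ^ 2) / (1 - x))) :
    x ≤ ∑ s ∈ (Finset.univ : Finset (Finset κ)).filter (fun s => j + 1 ≤ ∑ k ∈ s, a k),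
      (∏ k, if k ∈ s then p k else 1 - p k) :=
  tail_ge_of_heavyMerge_oneLight_le _ p a x₀ x j hp0 hp1 hx0 hx1 hgl hgu hbj le_rfl hM hH hcredit

end IndepBlob

end Quant

end Summit.CriticalPhenomena.PercolationContinuityZ3.Theorems
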